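import Summits.BirchSwinnertonDyer.Rank1Residual.Additive.ClassicalConditionAwayBadPlaces
import Literature.NumberTheory.EllipticCurves.Kobayashi2003.SignedSelmer
import HarnessLib

/-!
# Route `ThetaPartnerAtTwo` (TP2), crux K3 `SignedKatoDivisibilityUpToAtTwo` (item stmt-BirchSwinnertonDyer-20308),
# line `colemanrat` v5 — (Rec) SELMER SIDE AT FINITE LEVEL: Selmer classes OF EVERY LAYER `K_n` are LOCALLY TRIVIAL at
# every place `w ∤ p` (all conjugates, any reduction type) — the vanishing of the local terms `w ∤ p∞` of Poitou–Tate

Width seat `bsd-wall-tp2-p2x-w3` g3 (cell `bsd-wall`). HONEST FRAMING: THEOREMS ONLY — no definition, no named fact, no instance, no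
`sorry`; route-independent; closes no item; BSD is NOT proved by any of this.

## Why this file

The research stub (R2^ι) of skeleton `colemanrat` v5 has, after the K3 lead's points package and w2 g3's certificate
`…PackageOfResidue`, the residue «layer pairings + (PT-orth) + (ES+Z)». (PT-orth) = Poitou–Tate along `ℚ_∞` at FINITE level
(`Cruxes/SignedKatoDivisibilityUpToAtTwo/W3G2-RECIPROCITY-ROADMAP.md` §2–3): for `x ∈ 𝐇¹` and a layer-`n` Selmer class `s_n`,
`∑_w inv_w(loc_w x_n ∪ loc_w s_n) = 0`, and every local term at `w ∤ p∞` must vanish (§3(c)). The roadmap planned this via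
«unramified ∪ unramified» at good `w` and a layer-descended local TRIVIALITY at the finitely many bad `w` (§3(a),
`…SelmerLayerRep`). This file proves the stronger and simpler statement that makes §3(a)/(c) one line: **at every finite layer
`K_n` and EVERY `w ∤ p` (good or bad), every Selmer class is locally TRIVIAL in `H¹(K_{n,w}, E[p^∞])`** — Greenberg's
`Im κ_η = 0` (`E(K_{n,w}) ⊗ ℚ_p/ℤ_p = 0`) made effective exactly as in the cell's
`Rank1Residual.Additive.localKerOver_le_awayKer` (stated there for `H = ker κ` only), now for ANY closed `H ⊇ ker κ`, in
particular `H = κ.layerSubgroup n`. So the local term at `w ∤ p∞` of (PT-orth) is `inv_w(loc x_n ∪ 0) = 0` by bilinearity; no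
unramifiedness of `x_n` is needed.

## What is proved

* `localKerOver_le_awayKer_of_kerSubgroup_le` — any number field `K`, prime `p`, `ℤ_p`-extension `κ`, CLOSED `H` with
  `ker κ ≤ H`, `v ∤ p`, any elliptic `W`: `W.localKerOver p H K_v ≤ awayKer H E[p^∞] v` (the classical local condition
  «dies in `H¹(H_{K_v}, E(K̄_v))`» implies «dies on `H ⊓ D_v`»). Proof = the cell's proof with `ker κ` replaced by `H`
  (compactness of `H`; `I_v ≤ H_{K_v}` from `I_v ≤ (ker κ)_{K_v}`, `absInertia_le_localSubgroup_kerSubgroup`; FILE A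
  `exists_fixed_sub_pow_nsmul_mem_primaryComponent`).
* `localKerOver_layer_le_awayKer` (`H = κ.layerSubgroup n`), **`resOfLe_conjH1_eq_zero_of_mem_selmerLayer`** (for
  `s ∈ Sel_{p^∞}(E/K_n)`, every `v ∤ p` and every `σ ∈ Γ_K`: `res_{Γ_n ⊓ D_v}(conj_σ s) = 0`),
  **`resOfLe_conjH1_eq_zero_of_mem_signedSelmerLayer`** (the same for Kobayashi's `Sel^ε(E/K_n)`).

References: [GreenbergLNM1716, §2 Prop. 2.1 (p. 72), pp. 69–70]; [GreenbergVatsal2000, §2 p. 17]; [Kobayashi2003, Def. 1.1];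
[MilneADT2006, I §6].
-/

set_option autoImplicit false
-- the Theorems namespace of this sub repeats the summit name by design (D-0017 nested layout)
set_option linter.dupNamespace false

noncomputable section

open scoped Classical Pointwise NumberField

namespace Summit.BirchSwinnertonDyer.BirchSwinnertonDyer.Theorems

namespace SignedKatoOffTwo.LayerAway

open Literature.NumberTheory.GaloisRepresentations Literature.NumberTheory.EllipticCurves
  Literature.NumberTheory.EllipticCurves.ResKernel
  Summit.BirchSwinnertonDyer.Rank1Residual.X2.GreenbergVatsalUnramifiedAway
  NumberField IsDedekindDomain Field Literature.NumberTheory.EllipticCurves.GreenbergSelmer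
  Summit.BirchSwinnertonDyer.Rank1Residual.X2.GreenbergVatsalTorsion
  Summit.BirchSwinnertonDyer.Rank1Residual.X2.GreenbergVatsalTorsionCurve
  Summit.BirchSwinnertonDyer.Rank1Residual.Additive Literature.NumberTheory.EllipticCurves.Kobayashi2003

universe u

variable {K : Type u} [Field K] [NumberField K] {p : ℕ} [hp : Fact p.Prime] (κ : ZpExtension K p)
  (v : HeightOneSpectrum (𝓞 K))

variable (W : WeierstrassCurve K) [W.IsElliptic] (p)

/-- **The classical local condition at `v ∤ p` is "locally trivial" over EVERY closed `H ⊇ ker κ`** (e.g. every layer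
`Γ_n = κ.layerSubgroup n`): a class of `H¹(H, E[p^∞])` dying in `H¹(H_{K_v}, E(K̄_v))` dies on `H ⊓ D_v`. Greenberg's
`Im κ_η = 0`, made effective as in `Rank1Residual.Additive.localKerOver_le_awayKer` (the case `H = ker κ`).
[cite: GreenbergLNM1716, §2 Prop. 2.1 (p. 72) and pp. 69–70] [cite: GreenbergVatsal2000, §2 p. 17] -/
theorem localKerOver_le_awayKer_of_kerSubgroup_le (H : Subgroup (absoluteGaloisGroup K)) [H.Normal]
    (hH : IsClosed (H : Set (absoluteGaloisGroup K))) (hκH : κ.kerSubgroup ≤ H)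
    (hpv : ((p : ℕ) : 𝓞 K) ∉ v.asIdeal) :
    W.localKerOver p H (v.adicCompletion K) ≤ awayKer H (W.geomPrimaryTorsion p) v := by
  intro c hc
  obtain ⟨f, rfl⟩ := oneCocycleClass_surjective (discreteTopRep H (W.geomPrimaryTorsion p)) c
  obtain ⟨P, hP⟩ := (Summit.BirchSwinnertonDyer.Rank1Residual.X2.GreenbergVatsalSelmerLink.oneCocycleClass_mem_localKerOver_iff W p H _ f).1 hc
  rw [awayKer, AddMonoidHom.mem_ker, resOfLe_oneCocycleClass_eq_zero_iff H]
  haveI : NeZero p := ⟨hp.out.ne_zero⟩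
  -- a common exponent `p^k` killing every value of `f` (`H` is compact, the values are discrete)
  haveI : CompactSpace (absoluteGaloisGroup K) := absoluteGaloisGroup_compactSpace K
  haveI : CompactSpace ↥H := isCompact_iff_compactSpace.mp hH.isCompact
  have hfin : (Set.range f.1).Finite := (isCompact_range f.1.continuous).finite_of_discrete
  obtain ⟨k, hk⟩ : ∃ k : ℕ, ∀ x : ↥H, (p ^ k : ℕ) • ((f.1 x : W.geomPrimaryTorsion p) : W.geomPoints) = 0 := by
    let e : W.geomPrimaryTorsion p → ℕ := fun m ↦ ((AddCommGroup.mem_primaryComponent).1 m.2).choose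
    have he : ∀ m : W.geomPrimaryTorsion p, (p ^ e m : ℕ) • (m : W.geomPoints) = 0 := fun m ↦
      ((AddCommGroup.mem_primaryComponent).1 m.2).choose_spec
    refine ⟨hfin.toFinset.sup e, fun x ↦ ?_⟩
    have hle : e (f.1 x) ≤ hfin.toFinset.sup e := Finset.le_sup (hfin.mem_toFinset.mpr ⟨x, rfl⟩)
    obtain ⟨d, hd⟩ := Nat.exists_eq_add_of_le hle
    rw [hd, pow_add, mul_nsmul, he, nsmul_zero]
  -- `S = p^k • P` is fixed by `H_{K_v}`
  have hS : ∀ τ ∈ localSubgroup H (v.adicCompletion K), τ • ((p ^ k : ℕ) • P) = (p ^ k : ℕ) • P := fun τ hτ ↦ by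
    have e : (p ^ k : ℕ) • (τ • P - P) = 0 := by
      rw [← hP ⟨τ, hτ⟩, ← map_nsmul, hk, map_zero]
    rw [nsmul_sub, sub_eq_zero] at e
    rw [smul_comm, e]
  -- `I_v ≤ (ker κ)_{K_v} ≤ H_{K_v}`
  have hIH : absInertia (v.adicCompletion K) ≤ localSubgroup H (v.adicCompletion K) := fun τ hτ ↦ by
    have h := absInertia_le_localSubgroup_kerSubgroup (K := K) (p := p) (v := v) κ hpv hτ
    rw [mem_localSubgroup_iff] at h ⊢
    exact hκH h
  -- FILE A: `S = p^k • R + T`, `R` fixed by `H_{K_v} ⊇ I_{K_v}`, `T` of `p`-power order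
  obtain ⟨R, hR, hT⟩ := exists_fixed_sub_pow_nsmul_mem_primaryComponent W p v hpv
    (localSubgroup H (v.adicCompletion K)) hIH _ hS k
  -- `Q₀ = P - R` is `p`-power torsion, hence geometric
  have hQ₀ : P - R ∈ AddCommGroup.primaryComponent (localPoints W (v.adicCompletion K)) p := by
    refine PrimaryCoinvariants.mem_primaryComponent_of_nsmul_mem p (k := k) ?_
    rwa [nsmul_sub]
  obtain ⟨j, hj⟩ := (PrimaryCoinvariants.mem_primaryComponent_iff_exists_nsmul p _).mp hQ₀
  have hn : ((p ^ j : ℕ) : ℤ) ≠ 0 := by exact_mod_cast pow_ne_zero j hp.out.ne_zero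
  let Q₁ : AddSubgroup.torsionBy (localPoints W (v.adicCompletion K)) ((p ^ j : ℕ) : ℤ) :=
    ⟨P - R, AddSubgroup.torsionBy.nsmul_iff.mpr hj⟩
  let Qg : W.geomTorsion ((p ^ j : ℕ) : ℤ) :=
    (W.torsionPointsEquiv ((p ^ j : ℕ) : ℤ) (E := v.adicCompletion K) hn).symm Q₁
  have hQg : pointsMap W (v.adicCompletion K) (Qg : W.geomPoints) = P - R :=
    W.pointsMap_torsionPointsEquiv_symm ((p ^ j : ℕ) : ℤ) hn Q₁
  refine ⟨⟨(Qg : W.geomPoints), Summit.BirchSwinnertonDyer.Rank1Residual.X11b.Levels.geomTorsion_pow_le_geomPrimaryTorsion W p j Qg.2⟩, fun σ ↦ ?_⟩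
  -- lift `σ ∈ H ⊓ D_v` to `τ ∈ H_{K_v}` and read `f(σ) = ∂P(τ) = ∂Q(τ)`
  obtain ⟨τ, hτσ⟩ := (mem_decomp_iff v _).1 (Subgroup.mem_inf.1 σ.2).2
  have hτσ' : resGal (K := K) (v.adicCompletion K) τ = (σ : absoluteGaloisGroup K) := by
    rw [WeierstrassCurve.resGal_eq_absGaloisRestrict]; exact hτσ
  have hτH : τ ∈ localSubgroup H (v.adicCompletion K) := by
    rw [mem_localSubgroup_iff, hτσ']; exact (Subgroup.mem_inf.1 σ.2).1
  have e : resGalSubgroup H (v.adicCompletion K) ⟨τ, hτH⟩ =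
      subgroupInclusion (inf_le_left : H ⊓ decomp v ≤ H) σ := by
    apply Subtype.ext
    rw [resGalSubgroup_apply_coe, subgroupInclusion_apply_coe]
    exact hτσ'
  have key := hP ⟨τ, hτH⟩
  rw [e] at key
  apply Subtype.ext
  apply pointsMapOfEmb_injective W (closureEmb (K := K) (v.adicCompletion K))
  change pointsMap W (v.adicCompletion K) _ = pointsMap W (v.adicCompletion K) _
  rw [key, AddSubgroupClass.coe_sub, map_sub, primaryComponent.coe_smul, ← hτσ',
    pointsMap_smul W (v.adicCompletion K) τ, hQg, smul_sub, hR τ hτH]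
  abel

/-- **At every layer `K_n` and every `v ∤ p`, the classical local condition is "locally trivial".**
[cite: GreenbergLNM1716, §2 Prop. 2.1 (p. 72)] -/
theorem localKerOver_layer_le_awayKer (n : ℕ) (hpv : ((p : ℕ) : 𝓞 K) ∉ v.asIdeal) :
    W.localKerOver p (κ.layerSubgroup n) (v.adicCompletion K) ≤
      awayKer (κ.layerSubgroup n) (W.geomPrimaryTorsion p) v :=
  localKerOver_le_awayKer_of_kerSubgroup_le (κ := κ) (v := v) (W := W) (p := p) (κ.layerSubgroup n)
    (Subgroup.isClosed_of_isOpen _ (κ.isOpen_layerSubgroup n)) (κ.kerSubgroup_le_layerSubgroup n) hpv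

/-- **Layer-`n` Selmer classes are locally TRIVIAL at every `w ∤ p`**: for `s ∈ Sel_{p^∞}(E/K_n)`, every finite `v ∤ p` of `K`
and every `σ ∈ Γ_K` (i.e. every place `w` of `K_n` above `v`), `res_{Γ_n ⊓ D_v}(conj_σ s) = 0` in `H¹(K_{n,w}, E[p^∞])`. This is
the vanishing of the local terms at `w ∤ p∞` in the finite-level Poitou–Tate sum of (PT-orth) / (Rec).
[cite: GreenbergLNM1716, §2 Prop. 2.1 (p. 72)] [cite: MilneADT2006, I §6] -/
theorem resOfLe_conjH1_eq_zero_of_mem_selmerLayer (n : ℕ) {s : W.subgroupH1 p (κ.layerSubgroup n)}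
    (hs : s ∈ W.selmerLayer κ n) (hpv : ((p : ℕ) : 𝓞 K) ∉ v.asIdeal) (σ : absoluteGaloisGroup K) :
    resOfLe (W.geomPrimaryTorsion p) (inf_le_left : κ.layerSubgroup n ⊓ decomp v ≤ κ.layerSubgroup n)
      (W.conjH1 p (κ.layerSubgroup n) σ s) = 0 := by
  have h := ((W.mem_selmerGroupOver_iff p (κ.layerSubgroup n) s).1 hs).1 v σ
  exact localKerOver_layer_le_awayKer (κ := κ) (v := v) (W := W) (p := p) n hpv h

/-- The same without conjugation (`σ = 1`): `res_{Γ_n ⊓ D_v} s = 0`. [cite: GreenbergLNM1716, §2 Prop. 2.1 (p. 72)] -/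
theorem resOfLe_eq_zero_of_mem_selmerLayer (n : ℕ) {s : W.subgroupH1 p (κ.layerSubgroup n)}
    (hs : s ∈ W.selmerLayer κ n) (hpv : ((p : ℕ) : 𝓞 K) ∉ v.asIdeal) :
    resOfLe (W.geomPrimaryTorsion p) (inf_le_left : κ.layerSubgroup n ⊓ decomp v ≤ κ.layerSubgroup n) s = 0 := by
  have h := resOfLe_conjH1_eq_zero_of_mem_selmerLayer (κ := κ) (v := v) (W := W) (p := p) n hs hpv 1
  rwa [W.conjH1_one_holds p (κ.layerSubgroup n), AddMonoidHom.id_apply] at h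

/-- **Kobayashi's `Sel^ε(E/K_n)` classes are locally trivial at every `w ∤ p`** (`Sel^ε ≤ Sel`).
[cite: Kobayashi2003, Def. 1.1] [cite: GreenbergLNM1716, §2 Prop. 2.1 (p. 72)] -/
theorem resOfLe_conjH1_eq_zero_of_mem_signedSelmerLayer (ε : ℤˣ) (n : ℕ)
    {s : W.subgroupH1 p (κ.layerSubgroup n)} (hs : s ∈ signedSelmerLayer W κ ε n)
    (hpv : ((p : ℕ) : 𝓞 K) ∉ v.asIdeal) (σ : absoluteGaloisGroup K) :
    resOfLe (W.geomPrimaryTorsion p) (inf_le_left : κ.layerSubgroup n ⊓ decomp v ≤ κ.layerSubgroup n)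
      (W.conjH1 p (κ.layerSubgroup n) σ s) = 0 :=
  resOfLe_conjH1_eq_zero_of_mem_selmerLayer (κ := κ) (v := v) (W := W) (p := p) n
    (signedSelmerLayer_le_selmerLayer W κ ε n hs) hpv σ

end SignedKatoOffTwo.LayerAway

end Summit.BirchSwinnertonDyer.BirchSwinnertonDyer.Theorems

end
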